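import Mathlib
import Summits.Ventures.PercRepro2.LeafStep

/-!
# The `a₃`-leaf middle coefficient `R½` in the cross-correlation (exploration-from-`v`) form
(blind cell PercRepro2, p5 g25; `proofs/P5-OEDGE.md` §32, `proofs/subclaims/S4-HARDSTEP.md` v104)

For `a₃` a leaf at an unmarked vertex `v` (`LeafStep`: `Gc = (1 − q)² T₀ + 2q(1 − q) R½ + q² Gc(v)`),
the middle coefficient `R½ = T₀ + ½ Gc′` (`LeafStep.Rhalf`) is, with every moment under
`Q = {a₁ ↮ a₂}` and `L_x = 1{x ∈ C₁}`, `H_x = 1{x ∈ C₂}`, `U_x = L_x + H_x`, `N_xy = −Cov_Q(L_x, H_y)`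
(`≥ 0` by BHK06 Thm 1.4), `m_x = P(Q, x ∈ U)`:

  `R½ = P(Q)³ · [ (2 − m_v/P(Q)) (N_bo + N_ob) + (m_o/P(Q)) (N_bv + N_vb)
                  + Cov_Q(L_b, H_v U_o) + Cov_Q(H_b, L_v U_o) ]`.

Cleared of the denominators this is `Rhalf_eq_halfL_add_halfH`: `R½ = halfL + halfH`, where

* `anticov X Y = P(Q,X) P(Q,Y) − P(Q) P(Q,X,Y)` (`= P(Q)² · (−Cov_Q(1_X, 1_Y))`) — nonnegative for
  a `C₁`-event against a `C₂`-event (`anticov_nonneg_of_cross`, `anticov_nonneg_of_cross'`);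
* `threeC X Y = P(Q)² P(Q, X, Y, o ∈ U) − P(Q) P(Q,X) P(Q, Y, o ∈ U)` (`= P(Q)³ Cov_Q(1_X, 1_Y 1_{o∈U})`),
  the three-point cross term, of either sign;
* `halfL = (2P(Q) − m_v) · anticov(oH, bL) + m_o · anticov(vH, bL) + threeC(bL, vH)` and `halfH` its
  mirror (`C₁ ↔ C₂`).

The «`G2`» grouping `groupL = P(Q) anticov(oH, bL) + m_o anticov(vH, bL) + threeC(bL, vH)`
(`= P(Q)³·[N_bo + ⟨U_o⟩ N_bv + Cov_Q(L_b, H_v U_o)]`, so `halfL = (P(Q) − m_v)·anticov(oH, bL) + groupL`)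
splits as `groupL = crossA + crossB` with

* `crossB = P(Q)³·[Cov_Q(L_b, H_v H_o) − ⟨H_o⟩ Cov_Q(L_b, H_v) − Cov_Q(L_b, H_o)]` — **a theorem**
  (`crossB_nonneg`): `N(H_v H_o) ≤ N(H_o) + ⟨H_o⟩ N(H_v)`, by BHK06 Thm 1.4 under the pair avoidance
  `{a₂ ↮ a₁, a₂ ↮ v}` plus two mean shifts of the same sign;
* `crossA = P(Q)³·[Cov_Q(L_b, H_v L_o) − ⟨L_o⟩ Cov_Q(L_b, H_v)]` — of EITHER sign (exact witness,
  `proofs/P5-OEDGE.md` §32); `0 ≤ crossA + crossB` (census-true) is the open statement of the half.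

The reductions (row (LEAF-½) and the (Q1) margin from `0 ≤ groupL`, `0 ≤ groupH`, i.e. from the
(A)-terms alone once `crossB_nonneg` is in) are in `LeafHalfCrossRed.lean`.
-/

namespace Summit.Ventures.PercRepro2

open UnionCluster CovForm PendantRoot LeafStep

namespace LeafHalfCross

variable {V : Type*} {E : Type*} [Fintype E] [DecidableEq E] [Fintype V] [DecidableEq V]
  {R : Type*} [Field R] [LinearOrder R] [IsStrictOrderedRing R]

section Defs

variable (p : E → R) (ends : E → Sym2 V)

/-- **Cleared anticovariance under `Q`**: `P(Q,X)·P(Q,Y) − P(Q)·P(Q,X,Y)` (`= P(Q)²·(−Cov_Q(1_X, 1_Y))`). -/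
noncomputable def anticov (a₁ a₂ : V) (X Y : Set (Config E)) : R :=
  prob p (avoidAll ends a₂ {a₁} ∩ X) * prob p (avoidAll ends a₂ {a₁} ∩ Y) -
    prob p (avoidAll ends a₂ {a₁}) * prob p (avoidAll ends a₂ {a₁} ∩ (X ∩ Y))

/-- **Cleared three-point cross term**: `P(Q)²·P(Q, Y, o ∈ U, X) − P(Q)·P(Q,X)·P(Q, Y, o ∈ U)`
(`= P(Q)³·Cov_Q(1_X, 1_Y·1_{o ∈ U})`), with `o ∈ U` split as `oL + oH`. -/
noncomputable def threeC (o a₁ a₂ : V) (X Y : Set (Config E)) : R :=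
  prob p (avoidAll ends a₂ {a₁}) ^ 2 *
      (prob p (avoidAll ends a₂ {a₁} ∩ (Y ∩ (connEvent ends a₁ o ∩ X))) +
        prob p (avoidAll ends a₂ {a₁} ∩ (Y ∩ (connEvent ends a₂ o ∩ X)))) -
    prob p (avoidAll ends a₂ {a₁}) * prob p (avoidAll ends a₂ {a₁} ∩ X) *
      (prob p (avoidAll ends a₂ {a₁} ∩ (Y ∩ connEvent ends a₁ o)) +
        prob p (avoidAll ends a₂ {a₁} ∩ (Y ∩ connEvent ends a₂ o)))

/-- **The `C₁`-half of `R½`**: `(2P(Q) − m_v)·anticov(oH, bL) + m_o·anticov(vH, bL) + threeC(bL, vH)`. -/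
noncomputable def halfL (o a₁ a₂ v b : V) : R :=
  (2 * prob p (avoidAll ends a₂ {a₁}) - mU p ends a₁ a₂ v) *
      anticov p ends a₁ a₂ (connEvent ends a₂ o) (connEvent ends a₁ b) +
    mU p ends a₁ a₂ o * anticov p ends a₁ a₂ (connEvent ends a₂ v) (connEvent ends a₁ b) +
    threeC p ends o a₁ a₂ (connEvent ends a₁ b) (connEvent ends a₂ v)

/-- **The `C₂`-half of `R½`** (the mirror of `halfL`):
`(2P(Q) − m_v)·anticov(oL, bH) + m_o·anticov(vL, bH) + threeC(bH, vL)`. -/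
noncomputable def halfH (o a₁ a₂ v b : V) : R :=
  (2 * prob p (avoidAll ends a₂ {a₁}) - mU p ends a₁ a₂ v) *
      anticov p ends a₁ a₂ (connEvent ends a₁ o) (connEvent ends a₂ b) +
    mU p ends a₁ a₂ o * anticov p ends a₁ a₂ (connEvent ends a₁ v) (connEvent ends a₂ b) +
    threeC p ends o a₁ a₂ (connEvent ends a₂ b) (connEvent ends a₁ v)

/-- The «`G2`» grouping of the `C₁`-half: `P(Q)·anticov(oH, bL) + m_o·anticov(vH, bL) + threeC(bL, vH)`
(`= P(Q)³·[N_bo + ⟨U_o⟩ N_bv + Cov_Q(L_b, H_v U_o)]`). -/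
noncomputable def groupL (o a₁ a₂ v b : V) : R :=
  prob p (avoidAll ends a₂ {a₁}) *
      anticov p ends a₁ a₂ (connEvent ends a₂ o) (connEvent ends a₁ b) +
    mU p ends a₁ a₂ o * anticov p ends a₁ a₂ (connEvent ends a₂ v) (connEvent ends a₁ b) +
    threeC p ends o a₁ a₂ (connEvent ends a₁ b) (connEvent ends a₂ v)

/-- The «`G2`» grouping of the `C₂`-half (the mirror of `groupL`). -/
noncomputable def groupH (o a₁ a₂ v b : V) : R :=
  prob p (avoidAll ends a₂ {a₁}) *
      anticov p ends a₁ a₂ (connEvent ends a₁ o) (connEvent ends a₂ b) +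
    mU p ends a₁ a₂ o * anticov p ends a₁ a₂ (connEvent ends a₁ v) (connEvent ends a₂ b) +
    threeC p ends o a₁ a₂ (connEvent ends a₂ b) (connEvent ends a₁ v)

end Defs

section Identity

variable (p : E → R) (ends : E → Sym2 V)

omit [Fintype V] in
/-- **The identity**: `R½ = halfL + halfH` — the middle Bernstein coefficient of the `a₃`-leaf
expansion in the cross-correlation form. -/
theorem Rhalf_eq_halfL_add_halfH (o a₁ a₂ v b : V) :
    Rhalf p ends o a₁ a₂ v b = halfL p ends o a₁ a₂ v b + halfH p ends o a₁ a₂ v b := by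
  unfold Rhalf T0 Gc1 halfL halfH anticov threeC mU mUU
  unfold EQbo EQb3 EQb3o EQo EQ3 EQ3o PDb PDbo Do
  rw [gap_eq_Q]
  simp only [prob_T_v p ends a₁ a₂ v, prob_T'_v p ends a₁ a₂ v,
    prob_PD_inter_v p ends a₁ a₂ v, prob_T_inter_v p ends a₁ a₂ v, prob_T'_inter_v p ends a₁ a₂ v]
  ring

omit [Fintype V] [DecidableEq V] [LinearOrder R] [IsStrictOrderedRing R] in
/-- `halfL = (P(Q) − m_v)·anticov(oH, bL) + groupL`. -/
theorem halfL_eq (o a₁ a₂ v b : V) :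
    halfL p ends o a₁ a₂ v b =
      (prob p (avoidAll ends a₂ {a₁}) - mU p ends a₁ a₂ v) *
          anticov p ends a₁ a₂ (connEvent ends a₂ o) (connEvent ends a₁ b) +
        groupL p ends o a₁ a₂ v b := by
  unfold halfL groupL
  ring

omit [Fintype V] [DecidableEq V] [LinearOrder R] [IsStrictOrderedRing R] in
/-- `halfH = (P(Q) − m_v)·anticov(oL, bH) + groupH`. -/
theorem halfH_eq (o a₁ a₂ v b : V) :
    halfH p ends o a₁ a₂ v b =
      (prob p (avoidAll ends a₂ {a₁}) - mU p ends a₁ a₂ v) *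
          anticov p ends a₁ a₂ (connEvent ends a₁ o) (connEvent ends a₂ b) +
        groupH p ends o a₁ a₂ v b := by
  unfold halfH groupH
  ring

end Identity

section Signs

variable (p : E → R) (ends : E → Sym2 V)

/-- **BHK06 Thm 1.4 under `Q`, cleared**: `0 ≤ anticov(xL, yH)` — `x ∈ C₁` and `y ∈ C₂` are
negatively correlated given `a₁ ↮ a₂`. -/
theorem anticov_nonneg_of_cross (hp : IsProbVec p) (a₁ a₂ x y : V) :
    0 ≤ anticov p ends a₁ a₂ (connEvent ends a₁ x) (connEvent ends a₂ y) := by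
  have h := bhk_cross_cluster p hp ends a₁ a₂ (isUpperSet_mem_setOf x) (isUpperSet_mem_setOf y)
  rw [← connEvent_eq_clusterInEvent ends a₁ x, ← connEvent_eq_clusterInEvent ends a₂ y,
    ← avoidAll_eq_compl] at h
  have e1 : connEvent ends a₁ x ∩ avoidAll ends a₂ {a₁} = avoidAll ends a₂ {a₁} ∩ connEvent ends a₁ x :=
    Set.inter_comm _ _
  have e2 : connEvent ends a₂ y ∩ avoidAll ends a₂ {a₁} = avoidAll ends a₂ {a₁} ∩ connEvent ends a₂ y :=
    Set.inter_comm _ _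
  have e3 : connEvent ends a₁ x ∩ connEvent ends a₂ y ∩ avoidAll ends a₂ {a₁} =
      avoidAll ends a₂ {a₁} ∩ (connEvent ends a₁ x ∩ connEvent ends a₂ y) := Set.inter_comm _ _
  rw [e1, e2, e3] at h
  unfold anticov
  linarith

/-- **BHK06 Thm 1.4 under `Q`, cleared, the other order**: `0 ≤ anticov(xH, yL)`. -/
theorem anticov_nonneg_of_cross' (hp : IsProbVec p) (a₁ a₂ x y : V) :
    0 ≤ anticov p ends a₁ a₂ (connEvent ends a₂ x) (connEvent ends a₁ y) := by
  have h := anticov_nonneg_of_cross p ends hp a₁ a₂ y x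
  unfold anticov at h ⊢
  rw [Set.inter_comm (connEvent ends a₂ x) (connEvent ends a₁ y)]
  linarith

omit [Fintype V] in
/-- The `(2P(Q) − m_v)` and `(P(Q) − m_v)` coefficients are nonnegative: `m_v ≤ P(Q)`
(`P(Q, v ∈ C₁) + P(Q, v ∈ C₂) ≤ P(Q)`, the two events being disjoint under `Q`). -/
theorem mU_le_Q (hp : IsProbVec p) (a₁ a₂ v : V) :
    mU p ends a₁ a₂ v ≤ prob p (avoidAll ends a₂ {a₁}) := by
  have h := prob_PD_v p ends a₁ a₂ v
  have h0 := prob_nonneg hp (PDEvent ends a₁ a₂ v)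
  unfold mU
  linarith

end Signs

/-! ## The (B)-term is a theorem: `N(H_v H_o) ≤ N(H_o) + ⟨H_o⟩ N(H_v)` under `Q` -/

section CrossB

variable (p : E → R) (ends : E → Sym2 V)

/-- **`Q³·Φ(L_o)`, cleared** — the (A)-term of the `C₁`-half:
`Q²·P(Q, vH, oL, bL) − Q·P(Q, bL)·P(Q, vH, oL) + P(Q, oL)·anticov(vH, bL)`
(`= Q³·[Cov_Q(L_b, H_v L_o) − ⟨L_o⟩ Cov_Q(L_b, H_v)]`); of either sign (exact witness in
`proofs/P5-OEDGE.md` §32). -/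
noncomputable def crossA (o a₁ a₂ v b : V) : R :=
  prob p (avoidAll ends a₂ {a₁}) ^ 2 *
      prob p (avoidAll ends a₂ {a₁} ∩
        (connEvent ends a₂ v ∩ (connEvent ends a₁ o ∩ connEvent ends a₁ b))) -
    prob p (avoidAll ends a₂ {a₁}) * prob p (avoidAll ends a₂ {a₁} ∩ connEvent ends a₁ b) *
      prob p (avoidAll ends a₂ {a₁} ∩ (connEvent ends a₂ v ∩ connEvent ends a₁ o)) +
    prob p (avoidAll ends a₂ {a₁} ∩ connEvent ends a₁ o) *
      anticov p ends a₁ a₂ (connEvent ends a₂ v) (connEvent ends a₁ b)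

/-- **`Q³·[N_bo + ⟨H_o⟩ N_bv − N(H_v H_o)]`, cleared** — the (B)-term of the `C₁`-half:
`Q·anticov(oH, bL) + P(Q, oH)·anticov(vH, bL) − [Q·P(Q, bL)·P(Q, vH, oH) − Q²·P(Q, vH, oH, bL)]`
(`= Q³·[Cov_Q(L_b, H_v H_o) − ⟨H_o⟩ Cov_Q(L_b, H_v) − Cov_Q(L_b, H_o)]`). -/
noncomputable def crossB (o a₁ a₂ v b : V) : R :=
  prob p (avoidAll ends a₂ {a₁}) *
      anticov p ends a₁ a₂ (connEvent ends a₂ o) (connEvent ends a₁ b) +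
    prob p (avoidAll ends a₂ {a₁} ∩ connEvent ends a₂ o) *
      anticov p ends a₁ a₂ (connEvent ends a₂ v) (connEvent ends a₁ b) -
    (prob p (avoidAll ends a₂ {a₁}) * prob p (avoidAll ends a₂ {a₁} ∩ connEvent ends a₁ b) *
        prob p (avoidAll ends a₂ {a₁} ∩ (connEvent ends a₂ v ∩ connEvent ends a₂ o)) -
      prob p (avoidAll ends a₂ {a₁}) ^ 2 *
        prob p (avoidAll ends a₂ {a₁} ∩
          (connEvent ends a₂ v ∩ (connEvent ends a₂ o ∩ connEvent ends a₁ b))))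

omit [Fintype V] [DecidableEq V] [LinearOrder R] [IsStrictOrderedRing R] in
/-- `groupL = crossA + crossB`: the «`G2`» grouping is the (A)-term plus the (B)-term. -/
theorem groupL_eq_crossA_add_crossB (o a₁ a₂ v b : V) :
    groupL p ends o a₁ a₂ v b = crossA p ends o a₁ a₂ v b + crossB p ends o a₁ a₂ v b := by
  unfold groupL crossA crossB threeC mU
  ring

omit [Fintype E] [DecidableEq E] [Fintype V] in
/-- `{a₂ ↮ a₁, a₂ ↮ v} = Q ∩ {v ∉ C₂}`. -/
lemma avoidAll_pair_eq_Q_inter (a₁ a₂ v : V) :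
    avoidAll ends a₂ {a₁, v} = avoidAll ends a₂ {a₁} ∩ (connEvent ends a₂ v)ᶜ := by
  ext ω
  simp only [avoidAll, Set.mem_setOf_eq, Finset.mem_insert, Finset.mem_singleton,
    forall_eq_or_imp, forall_eq, Set.mem_inter_iff, Set.mem_compl_iff, mem_connEvent]

omit [Fintype E] [DecidableEq E] [Fintype V] [DecidableEq V] in
/-- `Q = {a₂ ↔ a₁}ᶜ`. -/
lemma Q_eq_compl_conn (a₁ a₂ : V) :
    avoidAll ends a₂ {a₁} = (connEvent ends a₂ a₁)ᶜ := by
  ext ω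
  simp only [avoidAll, Set.mem_setOf_eq, Finset.mem_singleton, forall_eq, Set.mem_compl_iff,
    mem_connEvent]

omit [Fintype V] [LinearOrder R] [IsStrictOrderedRing R] in
/-- Masses under the pair avoidance: `P(X, a₂ ↮ {a₁, v}) = P(Q, X) − P(Q, vH, X)`. -/
lemma prob_inter_avoidAll_pair (X : Set (Config E)) (a₁ a₂ v : V) :
    prob p (X ∩ avoidAll ends a₂ {a₁, v}) =
      prob p (avoidAll ends a₂ {a₁} ∩ X) -
        prob p (avoidAll ends a₂ {a₁} ∩ (connEvent ends a₂ v ∩ X)) := by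
  rw [avoidAll_pair_eq_Q_inter]
  have h := prob_inter_add_prob_inter_compl p (avoidAll ends a₂ {a₁} ∩ X) (connEvent ends a₂ v)
  have e1 : X ∩ (avoidAll ends a₂ {a₁} ∩ (connEvent ends a₂ v)ᶜ) =
      avoidAll ends a₂ {a₁} ∩ X ∩ (connEvent ends a₂ v)ᶜ := by
    ext ω; simp only [Set.mem_inter_iff, Set.mem_compl_iff]; tauto
  have e2 : avoidAll ends a₂ {a₁} ∩ X ∩ connEvent ends a₂ v =
      avoidAll ends a₂ {a₁} ∩ (connEvent ends a₂ v ∩ X) := by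
    ext ω; simp only [Set.mem_inter_iff]; tauto
  rw [e1, ← e2]
  linear_combination h

omit [Fintype V] [LinearOrder R] [IsStrictOrderedRing R] in
/-- `P(a₂ ↮ {a₁, v}) = P(Q) − P(Q, vH)`. -/
lemma prob_avoidAll_pair (a₁ a₂ v : V) :
    prob p (avoidAll ends a₂ {a₁, v}) =
      prob p (avoidAll ends a₂ {a₁}) - prob p (avoidAll ends a₂ {a₁} ∩ connEvent ends a₂ v) := by
  have h := prob_inter_avoidAll_pair p ends Set.univ a₁ a₂ v
  simpa only [Set.univ_inter, Set.inter_univ] using h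

/-- **BHK06 Thm 1.4 under the pair avoidance `{a₂ ↮ a₁, a₂ ↮ v}`**, in `Q`-masses:
`[P(Q,oH,bL) − P(Q,vH,oH,bL)]·[P(Q) − P(Q,vH)] ≤ [P(Q,oH) − P(Q,vH,oH)]·[P(Q,bL) − P(Q,vH,bL)]`
(`o ∈ C₂` and `b ∈ C₁` are negatively correlated given `a₂ ↮ a₁` and `v ∉ C₂`). -/
theorem cross_pair_avoid (hp : IsProbVec p) (o a₁ a₂ v b : V) :
    (prob p (avoidAll ends a₂ {a₁} ∩ (connEvent ends a₂ o ∩ connEvent ends a₁ b)) -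
        prob p (avoidAll ends a₂ {a₁} ∩
          (connEvent ends a₂ v ∩ (connEvent ends a₂ o ∩ connEvent ends a₁ b)))) *
      (prob p (avoidAll ends a₂ {a₁}) - prob p (avoidAll ends a₂ {a₁} ∩ connEvent ends a₂ v)) ≤
    (prob p (avoidAll ends a₂ {a₁} ∩ connEvent ends a₂ o) -
        prob p (avoidAll ends a₂ {a₁} ∩ (connEvent ends a₂ v ∩ connEvent ends a₂ o))) *
      (prob p (avoidAll ends a₂ {a₁} ∩ connEvent ends a₁ b) -
        prob p (avoidAll ends a₂ {a₁} ∩ (connEvent ends a₂ v ∩ connEvent ends a₁ b))) := by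
  have h := bhk_cross_cluster_avoid p hp ends a₂ a₁ (X := {a₁, v}) (Finset.mem_insert_self a₁ {v})
    (isUpperSet_mem_setOf o) (isUpperSet_mem_setOf b)
  rw [← connEvent_eq_clusterInEvent ends a₂ o, ← connEvent_eq_clusterInEvent ends a₁ b,
    prob_inter_avoidAll_pair, prob_inter_avoidAll_pair, prob_inter_avoidAll_pair,
    prob_avoidAll_pair] at h
  exact h

/-- **BHK06 Thm 1.1 under `Q`** for the two `C₂`-events `v ∈ C₂`, `o ∈ C₂`, in `Q`-masses:
`P(Q, vH)·P(Q, oH) ≤ P(Q, vH, oH)·P(Q)`. -/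
theorem same_cluster_vo (hp : IsProbVec p) (o a₁ a₂ v : V) :
    prob p (avoidAll ends a₂ {a₁} ∩ connEvent ends a₂ v) *
        prob p (avoidAll ends a₂ {a₁} ∩ connEvent ends a₂ o) ≤
      prob p (avoidAll ends a₂ {a₁} ∩ (connEvent ends a₂ v ∩ connEvent ends a₂ o)) *
        prob p (avoidAll ends a₂ {a₁}) := by
  have h := bhk_same_cluster_events p hp ends a₂ a₁ (isUpperSet_mem_setOf v) (isUpperSet_mem_setOf o)
  rw [← connEvent_eq_clusterInEvent ends a₂ v, ← connEvent_eq_clusterInEvent ends a₂ o,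
    ← Q_eq_compl_conn] at h
  have e1 : connEvent ends a₂ v ∩ avoidAll ends a₂ {a₁} =
      avoidAll ends a₂ {a₁} ∩ connEvent ends a₂ v := Set.inter_comm _ _
  have e2 : connEvent ends a₂ o ∩ avoidAll ends a₂ {a₁} =
      avoidAll ends a₂ {a₁} ∩ connEvent ends a₂ o := Set.inter_comm _ _
  have e3 : connEvent ends a₂ v ∩ connEvent ends a₂ o ∩ avoidAll ends a₂ {a₁} =
      avoidAll ends a₂ {a₁} ∩ (connEvent ends a₂ v ∩ connEvent ends a₂ o) := Set.inter_comm _ _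
  rw [e1, e2, e3] at h
  exact h

/-- **THEOREM (B)**: `0 ≤ crossB` — under `Q`, `N(H_v H_o) ≤ N(H_o) + ⟨H_o⟩·N(H_v)`, i.e.
`Cov_Q(L_b, H_v H_o) − ⟨H_o⟩ Cov_Q(L_b, H_v) ≥ Cov_Q(L_b, H_o)`.

Proof: `crossB = Q³·E_Q[(β − L_b)(H_o − c)·1{v ∉ C₂}]` with `β = ⟨L_b⟩`, `c = ⟨H_o⟩`, and on
`{v ∉ C₂}` the product splits as a conditional covariance (BHK06 Thm 1.4 under the pair avoidance
`{a₂ ↮ a₁, a₂ ↮ v}`: `cross_pair_avoid`) plus the product of two mean shifts of the same sign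
(`anticov_nonneg_of_cross'` for `b`, `same_cluster_vo` for `o`): the identity
`[Q − P(Q,vH)]·crossB = Q²·s₁ + s₂·s₃` with the three slacks `s₁, s₂, s₃ ≥ 0`. -/
theorem crossB_nonneg (hp : IsProbVec p) (o a₁ a₂ v b : V) :
    0 ≤ crossB p ends o a₁ a₂ v b := by
  have hF1 := cross_pair_avoid p ends hp o a₁ a₂ v b
  have hF2 := anticov_nonneg_of_cross' p ends hp a₁ a₂ v b
  have hF3 := same_cluster_vo p ends hp o a₁ a₂ v
  unfold crossB
  unfold anticov at hF2 ⊢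
  set Q := prob p (avoidAll ends a₂ {a₁}) with hQ
  set B := prob p (avoidAll ends a₂ {a₁} ∩ connEvent ends a₁ b) with hB
  set O := prob p (avoidAll ends a₂ {a₁} ∩ connEvent ends a₂ o) with hO
  set Vm := prob p (avoidAll ends a₂ {a₁} ∩ connEvent ends a₂ v) with hV
  set BO := prob p (avoidAll ends a₂ {a₁} ∩ (connEvent ends a₂ o ∩ connEvent ends a₁ b)) with hBO
  set BV := prob p (avoidAll ends a₂ {a₁} ∩ (connEvent ends a₂ v ∩ connEvent ends a₁ b)) with hBV
  set VO := prob p (avoidAll ends a₂ {a₁} ∩ (connEvent ends a₂ v ∩ connEvent ends a₂ o)) with hVO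
  set BVO := prob p (avoidAll ends a₂ {a₁} ∩
    (connEvent ends a₂ v ∩ (connEvent ends a₂ o ∩ connEvent ends a₁ b))) with hBVO
  -- the three nonnegative slacks
  have hs1 : 0 ≤ (O - VO) * (B - BV) - (BO - BVO) * (Q - Vm) := by linarith
  have hs2 : 0 ≤ Vm * B - Q * BV := hF2
  have hs3 : 0 ≤ Q * VO - O * Vm := by linarith
  -- the bounds that settle the degenerate case `P(Q, v ∉ C₂) = 0`
  have hW : 0 ≤ Q - Vm := by
    rw [← prob_avoidAll_pair]; exact prob_nonneg hp _
  have hBp : B - BV ≤ Q - Vm := by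
    rw [← prob_avoidAll_pair, ← prob_inter_avoidAll_pair]
    exact prob_mono hp Set.inter_subset_right
  have hBp0 : 0 ≤ B - BV := by
    rw [← prob_inter_avoidAll_pair]; exact prob_nonneg hp _
  have hOp : O - VO ≤ Q - Vm := by
    rw [← prob_avoidAll_pair, ← prob_inter_avoidAll_pair]
    exact prob_mono hp Set.inter_subset_right
  have hOp0 : 0 ≤ O - VO := by
    rw [← prob_inter_avoidAll_pair]; exact prob_nonneg hp _
  have hBOp : BO - BVO ≤ Q - Vm := by
    rw [← prob_avoidAll_pair, ← prob_inter_avoidAll_pair]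
    exact prob_mono hp Set.inter_subset_right
  have hBOp0 : 0 ≤ BO - BVO := by
    rw [← prob_inter_avoidAll_pair]; exact prob_nonneg hp _
  have hQ0 : 0 ≤ Q := prob_nonneg hp _
  -- the certificate identity
  have key : (Q - Vm) * (Q * (O * B - Q * BO) + O * (Vm * B - Q * BV) -
      (Q * B * VO - Q ^ 2 * BVO)) =
      Q ^ 2 * ((O - VO) * (B - BV) - (BO - BVO) * (Q - Vm)) + (Vm * B - Q * BV) * (Q * VO - O * Vm) := by
    ring
  rcases lt_or_eq_of_le hW with hWpos | hWzero
  · by_contra hneg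
    have hneg' := lt_of_not_ge hneg
    have : (Q - Vm) * (Q * (O * B - Q * BO) + O * (Vm * B - Q * BV) -
        (Q * B * VO - Q ^ 2 * BVO)) < 0 := mul_neg_of_pos_of_neg hWpos hneg'
    nlinarith [mul_nonneg (sq_nonneg Q) hs1, mul_nonneg hs2 hs3]
  · -- `P(Q, v ∉ C₂) = 0`: every `¬v`-mass vanishes and `crossB = 0`
    have e1 : B = BV := by linarith
    have e2 : O = VO := by linarith
    have e3 : BO = BVO := by linarith
    have e4 : Vm = Q := by linarith
    rw [e1, e2, e3, e4]
    ring_nf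
    exact le_refl _

end CrossB

end LeafHalfCross

end Summit.Ventures.PercRepro2
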